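import Mathlib
import Literature.Analysis.FluidPDE.GalerkinFlow
import HarnessLib

/-!
# Stub `stub_enstrophy_hasDerivAt` — line `Sketch` of the crux `WazewskiBlock.UniformGalerkinTrap`
# (stmt-AnomalousDissipation-10352)

The derivative of the ENSTROPHY face `Zc(c) = 4π² ∑_k |k|² ‖c k‖²` of the three-face Ważewski block
along the Galerkin phase semiflow `galerkinPhaseFlow ν ĝ` (`ĝ = fourierRestrict (freqBall N) f`,
`Literature/Analysis/FluidPDE/GalerkinFlow.lean`): at every `t > 0`,
`d/dt Zc(Φ_t x) = 4π² ∑_k |k|² · 2 Re⟪(Φ_t x) k, V(Φ_t x) k⟫`, `V = galerkinRHS`.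

Route: the orbit `s ↦ ↑(Φ_s x) = galerkinCoeffFlow ν ĝ s ↑x` is a global solution of the Galerkin
ODE (`isGalerkinODESolution_galerkinCoeffFlow`), hence differentiable at `t > 0` with derivative
`galerkinRHS _ ν ĝ (Φ_t x)` (`IsGalerkinODESolution.hasDerivAt`); then coordinatewise
`HasDerivAt.norm_sq` (weighted by `|k|²`), summed over `k` and scaled by `4π²` — a weighted copy
of the tree's `hasDerivWithinAt_sum_norm_sq` (`NSHopfGalerkinExistence.lean`).
-/

noncomputable section
-- `Summit.<Summit>.<Problem>` is the tree's mandated summit-side namespace (CONVENTIONS §2); deliberate duplicate.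
set_option linter.dupNamespace false
namespace Summit.AnomalousDissipation.AnomalousDissipation.Theorems.UniformGalerkinTrap.Sketch
open MeasureTheory Set Filter Topology
open scoped ENNReal NNReal InnerProductSpace
open Literature.Analysis.FunctionSpaces Literature.Analysis.FunctionSpaces.Torus
open Literature.Analysis.FluidPDE

/-- Weighted derivative of the coefficient enstrophy along a differentiable curve in `S → ℂ^d`:
`d/dt ∑_k w k ‖β k‖² = ∑_k w k · 2 Re ⟪β k, β' k⟫` (weighted form of the tree's
`hasDerivWithinAt_sum_norm_sq`). -/
theorem hasDerivAt_sum_mul_norm_sq {d : Type*} [Fintype d] {S : Finset (d → ℤ)}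
    {β : ℝ → ↥S → EuclideanSpace ℂ d} {v : ↥S → EuclideanSpace ℂ d} {t : ℝ}
    (w : ↥S → ℝ) (h : HasDerivAt β v t) :
    HasDerivAt (fun τ => ∑ k, w k * ‖β τ k‖ ^ 2)
      (∑ k, w k * (2 * (inner ℂ (β t k) (v k)).re)) t := by
  have hk : ∀ k : ↥S, HasDerivAt (fun τ => β τ k) (v k) t := fun k =>
    (ContinuousLinearMap.proj (R := ℝ) (φ := fun _ : ↥S => EuclideanSpace ℂ d) k).hasFDerivAt
      |>.comp_hasDerivAt t h
  have := HasDerivAt.fun_sum (u := Finset.univ) fun k _ => ((hk k).norm_sq).const_mul (w k)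
  simp only [real_inner_eq_re_inner_euclidean] at this
  convert this using 1

/-- **The enstrophy face derivative along the Galerkin phase flow.** For `ν ≥ 0`, `f ∈ L²` and a
phase point `x`, at every `t > 0`,
`d/dt 4π² ∑_k |k|² ‖(Φ_t x) k‖² = 4π² ∑_k |k|² · 2 Re⟪(Φ_t x) k, galerkinRHS _ ν f̂ (Φ_t x) k⟫`
(chain rule through `IsGalerkinODESolution.hasDerivAt` for the orbit
`isGalerkinODESolution_galerkinCoeffFlow`). -/
theorem stub_enstrophy_hasDerivAt :
    ∀ (ν : ℝ) (N : ℕ) (f : UnitAddTorus (Fin 3) → EuclideanSpace ℝ (Fin 3))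
      (x : ↥(galerkinSubspace (freqBall N : Finset (Fin 3 → ℤ)))) (t : ℝ),
      0 ≤ ν → MemLp f 2 volume → 0 < t →
      HasDerivAt
        (fun s => 4 * Real.pi ^ 2 * ∑ k, Torus.freqNormSq ((k : ↥(freqBall N : Finset (Fin 3 → ℤ))) : Fin 3 → ℤ) *
            ‖(galerkinPhaseFlow ν (fourierRestrict (freqBall N : Finset (Fin 3 → ℤ)) f) s x :
              ↥(freqBall N : Finset (Fin 3 → ℤ)) → EuclideanSpace ℂ (Fin 3)) k‖ ^ 2)
        (4 * Real.pi ^ 2 * ∑ k, Torus.freqNormSq ((k : ↥(freqBall N : Finset (Fin 3 → ℤ))) : Fin 3 → ℤ) *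
            (2 * (inner ℂ ((galerkinPhaseFlow ν (fourierRestrict (freqBall N : Finset (Fin 3 → ℤ)) f) t x :
                ↥(freqBall N : Finset (Fin 3 → ℤ)) → EuclideanSpace ℂ (Fin 3)) k)
              (galerkinRHS (freqBall N : Finset (Fin 3 → ℤ)) ν (fourierRestrict (freqBall N : Finset (Fin 3 → ℤ)) f)
                (galerkinPhaseFlow ν (fourierRestrict (freqBall N : Finset (Fin 3 → ℤ)) f) t x :
                  ↥(freqBall N : Finset (Fin 3 → ℤ)) → EuclideanSpace ℂ (Fin 3)) k)).re)) t := by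
  intro ν N f x t hν hf ht
  have hg : IsRealCoeff (fourierRestrict (freqBall N : Finset (Fin 3 → ℤ)) f) :=
    isRealCoeff_mFourierCoeff (hf.integrable one_le_two)
  have hα := (isGalerkinODESolution_galerkinCoeffFlow hν neg_mem_freqBall_of_mem hg x.2).hasDerivAt ht
  exact (hasDerivAt_sum_mul_norm_sq
    (fun k : ↥(freqBall N : Finset (Fin 3 → ℤ)) => Torus.freqNormSq (k : Fin 3 → ℤ)) hα).const_mul
    (4 * Real.pi ^ 2)

end Summit.AnomalousDissipation.AnomalousDissipation.Theorems.UniformGalerkinTrap.Sketch
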